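import Summits.KontsevichZagierPeriods.KontsevichZagierPeriods.Theorems.SoloBlindLines
import Summits.KontsevichZagierPeriods.KontsevichZagierPeriods.Theorems.SoloBlindEta
import Summits.KontsevichZagierPeriods.KontsevichZagierPeriods.Theorems.SoloBlindTwoLogs
import Literature.NumberTheory.Transcendental.BoxIntegralHurwitzWeightTwo
import HarnessLib

/-!
# Two `ℚ`-linear sectors decided by arithmetic holonomy bounds (Calegari–Dimitrov–Tang 2024)

Solo programme `solo-KontsevichZagierPeriods-blind`, session 93.

`SoloBlindLines` proved the Kontsevich–Zagier conjecture on any `ℚ`-LINEAR SECTOR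
`L(g) = {z | [z] ∈ Σ ℚ·gᵢ}` whose values `evalQ gᵢ` are `ℚ`-linearly independent
(`kz_linSector`), and instantiated it with IRRATIONALITY inputs (Apéry, Ball–Rivoal).  The 2024
method of *arithmetic holonomy bounds* of Calegari–Dimitrov–Tang [CDT24, arXiv:2408.15403]
produces exactly such inputs, for two families of genuinely two-dimensional rational periods that
no transcendence theorem reaches:

* **[CDT24, Theorem 1]**: `1, π², L(2,χ₋₃)` are linearly independent over `ℚ`, where
  `L(2,χ₋₃) = Σ_{n≥0} (1/(3n+1)² − 1/(3n+2)²)`;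
* **[CDT24, Theorem 3]**: for integers `m ≠ n` outside `{-1, 0}` with `|m/n − 1| < 10⁻⁶`,
  `1, log(1+1/m), log(1+1/n), log(1+1/m)·log(1+1/n)` are linearly independent over `ℚ`.

Theorem 1 is the tree's NAMED FACT `calegariDimitrovTang_linearIndependent`
(`Literature/…/CalegariDimitrovTangL2Chi3.lean`, with the glue constant `L2chi3` and, in
`BoxIntegralLTwoChiThree.lean`, the box integral `∫_{(0,1)²} dx/(1+x₀x₁+(x₀x₁)²) = L2chi3`); it
enters `kz_chiThreeSector` as the hypothesis `(h : calegariDimitrovTang_linearIndependent)`.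
Theorem 3 is not in Mathlib or the Literature and enters `kz_logPairSector_succ` as an EXPLICIT
HYPOTHESIS, transcribed verbatim from its displayed conclusion.  What this
file PROVES is the Kontsevich–Zagier side:

* the `ℚ`-rational box `C = [(0,1)², dx dy/(1 + xy + x²y²)]` (`chiThreeBox`, the Literature's
  integrand packaged as an `IntegralRep` of KZ's literal rational shape) has value `L2chi3`
  (`chiThreeBox_value`) and satisfies the move `[T₀] − [C] − [T₁] ∈ relations` against the
  level-`3` Hurwitz boxes `T_r = [(0,1)², (xy)ʳ/(1-(xy)³)]` (`1/(1-u³) = 1/(1+u+u²) + u/(1-u³)`;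
  the trigamma values of [CDT24, Cor. 2]);
* **[CDT24, Thm 1] ⟹ KZ holds on the sector `L(1, x_π², [C])`** (`kz_chiThreeSector`), which
  contains the rational constants, Beukers' square `[(0,1)², 1/(1-xy)]`, the triangle `Z` of
  `ζ(2)`, `B₂`, `C`, and the difference `[T₀] − [T₁]`;
* **[CDT24, Thm 3] ⟹ KZ holds on the sector `L(1, ℓ(a), ℓ(b), ℓ(a)ℓ(b))`**, `a = 1 + 1/m`,
  `b = 1 + 1/n` (`kz_logPairSector_succ`), which contains the unit log cells `L(1;a)`, `L(1;b)`
  and the two-dimensional box `L(1;a) × L(1;b) = [(1,a)×(1,b), dx dy/(xy)]` — an INHOMOGENEOUS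
  two-logarithm sector, where Baker's theorem is silent and `SoloBlindTwoLogs` had to stop at
  homogeneous forms;
* the irrationality halves alone give KZ on the `ℚ`-lines through `[C]` and through `ℓ(a)ℓ(b)`
  (`kz_chiThreeLine`, `kz_logProductLine`).

Honest scope.  The sectors are `ℚ`-linear, not `K₀ = ℚ̄ ∩ ℝ`-linear: arithmetic holonomy
gives nothing over `ℚ̄`, so these sectors do not enlarge the `K₀`-algebra on which `evalQ` is
known injective; `log 2 · log 3` (i.e. `m = 1, n = 2`) stays out of reach of [CDT24, Thm 3]; and
Catalan's constant `L(2,χ₋₄)` is, by the authors' own account, beyond the method.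

References: F. Calegari, V. Dimitrov, Y. Tang, *The linear independence of `1`, `ζ(2)`, and
`L(2,χ₋₃)`*, arXiv:2408.15403 (2024), Theorems 1, 3, Corollary 2, §14; —, *Arithmetic holonomy
bounds and their applications*, arXiv:2510.04156 (2025), Thm 2; F. Beukers, *A note on the
irrationality of ζ(2) and ζ(3)* (1979); M. Kontsevich, D. Zagier, *Periods* (2001), §1.
-/

noncomputable section

namespace Summit.KontsevichZagierPeriods.KontsevichZagierPeriods.Theorems

open Set MeasureTheory
open Literature.ModelTheory.ExponentialFields (IsSemialgebraic)
open MvPolynomial (aeval X)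
open Literature.NumberTheory.Transcendental
open Literature.NumberTheory.Transcendental.KZ

namespace SoloBlind

/-! ## Rational constants lie in every sector through `1` -/

/-- The rational constant cells `[K(q)]` lie in every linear sector whose first generator is `1`. -/
theorem constCell_mem_linSector_of_eq_one {k : ℕ} {g : Fin (k + 1) → Q} (hg : g 0 = 1) (q : ℚ) :
    of (constCell (((q : ℚ) : K₀) : ℝ) (K₀.isAlgebraic _)) ∈ linSector g :=
  mem_linSector_single 0 q (by
    rw [hg, ← kappa_apply, ← algebraMap_eq_kappa, Algebra.algebraMap_eq_smul_one])

/-! ## `L(2,χ₋₃)` as a rational box on the unit square -/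

/-- Points of the open square have all coordinates in `(0,1)` (membership, unfolded). -/
theorem mem_Ioo_of_mem_kzOpenBox {x : Fin 2 → ℝ} (hx : x ∈ kzOpenBox 2) (i : Fin 2) :
    x i ∈ Ioo (0 : ℝ) 1 :=
  hx i

/-- On the open square, `0 < 1 - (x₀x₁)³`. -/
theorem one_sub_mul_cube_pos {x : Fin 2 → ℝ} (hx : x ∈ kzOpenBox 2) :
    0 < 1 - (x 0 * x 1) ^ 3 := by
  have h := BoxIntegral.mul_mem_Ioo_of_mem_box (mem_Ioo_of_mem_kzOpenBox hx)
  have h3 : (x 0 * x 1) ^ 3 < 1 := pow_lt_one₀ h.1.le h.2 three_ne_zero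
  linarith

/-- On the open square, `0 < 1 + x₀x₁ + (x₀x₁)²`. -/
theorem one_add_mul_add_sq_pos {x : Fin 2 → ℝ} (hx : x ∈ kzOpenBox 2) :
    0 < 1 + x 0 * x 1 + (x 0 * x 1) ^ 2 := by
  have h := BoxIntegral.mul_mem_Ioo_of_mem_box (mem_Ioo_of_mem_kzOpenBox hx)
  nlinarith [h.1, sq_nonneg (x 0 * x 1)]

/-- The partial fraction behind the move: on the square,
`1/(1-u³) − u/(1-u³) = 1/(1 + u + u²)` (`u = x₀x₁`). -/
theorem hurwitz_integrand_sub {x : Fin 2 → ℝ} (hx : x ∈ kzOpenBox 2) :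
    (x 0 * x 1) ^ 0 / (1 - (x 0 * x 1) ^ 3) - (x 0 * x 1) ^ 1 / (1 - (x 0 * x 1) ^ 3) =
      1 / (1 + x 0 * x 1 + (x 0 * x 1) ^ 2) := by
  have h1 := (one_sub_mul_cube_pos hx).ne'
  have h2 := (one_add_mul_add_sq_pos hx).ne'
  have h3 : 1 - x 0 * x 1 ≠ 0 := by
    have h := BoxIntegral.mul_mem_Ioo_of_mem_box (mem_Ioo_of_mem_kzOpenBox hx)
    linarith [h.2]
  rw [show 1 - (x 0 * x 1) ^ 3 = (1 - x 0 * x 1) * (1 + x 0 * x 1 + (x 0 * x 1) ^ 2) by ring]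
  field_simp

/-- **The level-`3` Hurwitz boxes `T_r = [(0,1)², (x₀x₁)ʳ/(1 - (x₀x₁)³)]`** (`r = 0, 1`: the
trigamma values `ψ₁(1/3)/9`, `ψ₁(2/3)/9` of [CDT24, Cor. 2]); `ℚ`-rational, absolutely convergent
by the Literature's `BoxIntegral.integrableOn_box_pow_div_one_sub_pow`. -/
def hurwitzThreeBox (r : ℕ) : IntegralRep 2 :=
  ratRep (kzOpenBox 2) (fun x => (x 0 * x 1) ^ r / (1 - (x 0 * x 1) ^ 3)) ((X 0 * X 1) ^ r)
    (1 - (X 0 * X 1) ^ 3) (isSemialgebraic_kzOpenBox 2)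
    (fun x hx => by simpa using (one_sub_mul_cube_pos hx).ne')
    (fun x _ => by simp)
    (BoxIntegral.integrableOn_box_pow_div_one_sub_pow (m := 3) (by norm_num) r)

/-- **CDT's period as a box: `C = [(0,1)², dx/(1 + x₀x₁ + (x₀x₁)²)]`** — the Literature's
integrand (`integrableOn_box_kernel_chi3`) in KZ's literal rational shape. -/
def chiThreeBox : IntegralRep 2 :=
  ratRep (kzOpenBox 2) (fun x => 1 / (1 + x 0 * x 1 + (x 0 * x 1) ^ 2)) 1
    (1 + X 0 * X 1 + (X 0 * X 1) ^ 2) (isSemialgebraic_kzOpenBox 2)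
    (fun x hx => by simpa using (one_add_mul_add_sq_pos hx).ne')
    (fun x _ => by simp)
    integrableOn_box_kernel_chi3

/-- `T_r` is `ℚ`-rational. -/
theorem isRational_hurwitzThreeBox (r : ℕ) : (hurwitzThreeBox r).IsRational := isRational_ratRep

/-- `C` is `ℚ`-rational. -/
theorem isRational_chiThreeBox : chiThreeBox.IsRational := isRational_ratRep

/-- **`value T_r = Σ_k 1/(3k+r+1)²`** (the Literature's weight-`2` Hurwitz box integral,
`m = 3`). -/
theorem hurwitzThreeBox_value (r : ℕ) :
    (hurwitzThreeBox r).value = ∑' k : ℕ, 1 / ((3 : ℝ) * k + r + 1) ^ 2 := by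
  have h := BoxIntegral.setIntegral_box_pow_div_one_sub_pow (m := 3) (by norm_num) r
  simp only [Nat.cast_ofNat] at h
  exact h

/-- **`value C = L(2,χ₋₃)`** (`L2chi3`; the Literature's
`setIntegral_box_kernel_chi3`). -/
theorem chiThreeBox_value : chiThreeBox.value = L2chi3 :=
  setIntegral_box_kernel_chi3

/-- `evalQ [C] = L(2,χ₋₃)`. -/
theorem evalQ_mkQ_chiThreeBox : evalQ (mkQ (of chiThreeBox)) = L2chi3 := by
  rw [evalQ_mkQ, eval_of, chiThreeBox_value]

/-- **Rule (1)**: `[T₀] − [C] − [T₁] ∈ relations` (`1/(1-u³) = 1/(1+u+u²) + u/(1-u³)`). -/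
theorem hurwitz_sub_chi_sub_hurwitz_mem_relations :
    of (hurwitzThreeBox 0) - of chiThreeBox - of (hurwitzThreeBox 1) ∈ relations := by
  refine integrandAddRel_subset_relations
    ⟨2, hurwitzThreeBox 0, chiThreeBox, hurwitzThreeBox 1, rfl, rfl, fun x hx => ?_, rfl⟩
  have hx : x ∈ kzOpenBox 2 := hx
  show (x 0 * x 1) ^ 0 / (1 - (x 0 * x 1) ^ 3) =
    1 / (1 + x 0 * x 1 + (x 0 * x 1) ^ 2) + (x 0 * x 1) ^ 1 / (1 - (x 0 * x 1) ^ 3)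
  linarith [hurwitz_integrand_sub hx]

/-- `value C = value T₀ − value T₁` (read off from the move: `relations ≤ ker eval`). -/
theorem chiThreeBox_value_eq_sub :
    chiThreeBox.value = (hurwitzThreeBox 0).value - (hurwitzThreeBox 1).value := by
  have h : eval (of (hurwitzThreeBox 0) - of chiThreeBox - of (hurwitzThreeBox 1)) = 0 :=
    relations_le_ker_eval_holds hurwitz_sub_chi_sub_hurwitz_mem_relations
  rw [map_sub, map_sub, eval_of, eval_of, eval_of] at h
  linarith

/-- **`L(2,χ₋₃) = ψ₁(1/3)/9 − ψ₁(2/3)/9` as box values**: the defining series split along the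
move. -/
theorem L2chi3_eq_hurwitzThreeBox_sub :
    L2chi3 = (hurwitzThreeBox 0).value - (hurwitzThreeBox 1).value := by
  rw [← chiThreeBox_value, chiThreeBox_value_eq_sub]

/-! ## [CDT24, Theorem 1] ⟹ KZ on the sector `L(1, x_π², [C])` -/

/-- The three generators `1, x_π², [C]`. -/
def chiThreeGens : Fin 3 → Q := ![(1 : Q), xPi ^ 2, mkQ (of chiThreeBox)]

/-- Generator `0`. -/
@[simp] theorem chiThreeGens_zero : chiThreeGens 0 = 1 := rfl

/-- Generator `1`. -/
@[simp] theorem chiThreeGens_one : chiThreeGens 1 = xPi ^ 2 := rfl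

/-- Generator `2`. -/
@[simp] theorem chiThreeGens_two : chiThreeGens 2 = mkQ (of chiThreeBox) := rfl

/-- **The `χ₋₃`-sector** `L(1, x_π², [C])`: formal combinations whose class is
`c₀ + c₁x_π² + c₂[C]`, `cᵢ ∈ ℚ`. -/
abbrev chiThreeSector : AddSubgroup FormalRep := linSector chiThreeGens

/-- The values of the generators: `1, π², L(2,χ₋₃)`. -/
theorem evalQ_chiThreeGens :
    (fun i => evalQ (chiThreeGens i)) = ![(1 : ℝ), Real.pi ^ 2, L2chi3] := by
  funext i
  fin_cases i <;> simp [chiThreeGens, evalQ_xPi, chiThreeBox_value, Matrix.cons_val_zero,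
    Matrix.cons_val_one, Matrix.cons_val_two, Matrix.head_cons, Matrix.tail_cons]

/-- **[CDT24, Theorem 1] ⟹ the Kontsevich–Zagier conjecture on the `χ₋₃`-sector**: under the
Literature's named fact `calegariDimitrovTang_linearIndependent` (`1, π², L(2,χ₋₃)` linearly
independent over `ℚ`), any two integral representations (of any dimensions) whose classes are
`ℚ`-combinations of `1, x_π², [C]`, with equal values, are connected by the three moves. -/
theorem kz_chiThreeSector (hCDT : calegariDimitrovTang_linearIndependent)
    {n m : ℕ} (r : IntegralRep n) (r' : IntegralRep m) (hr : of r ∈ chiThreeSector)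
    (hr' : of r' ∈ chiThreeSector) (hv : r.value = r'.value) : Equivalent r r' :=
  kz_linSector
    (by rw [evalQ_chiThreeGens]; exact calegariDimitrovTang_linearIndependent_iff.mp hCDT)
    r r' hr hr' hv

/-- `C` lies in its sector. -/
theorem chiThreeBox_mem : of chiThreeBox ∈ chiThreeSector :=
  mem_linSector_single 2 1 (by simp [chiThreeGens, Matrix.cons_val_two, Matrix.tail_cons])

/-- The rational constants lie in the sector. -/
theorem constCell_mem_chiThreeSector (q : ℚ) :
    of (constCell (((q : ℚ) : K₀) : ℝ) (K₀.isAlgebraic _)) ∈ chiThreeSector :=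
  constCell_mem_linSector_of_eq_one chiThreeGens_zero q

/-- The triangle `Z = [{0<y<x<1}, 1/((1-x)y)]` of `ζ(2)` lies in the sector (`6[Z] = x_π²`). -/
theorem zetaTwoRep_mem_chiThreeSector : of zetaTwoRep ∈ chiThreeSector := by
  refine mem_linSector_single 1 (1 / 6) ?_
  have hc : ((1 / 6 : ℚ) : K₀) * 6 = 1 := by
    push_cast
    norm_num
  rw [chiThreeGens_one, ← six_smul_mkQ_zetaTwoRep, smul_smul, hc, one_smul]

/-- Beukers' square `[(0,1)², 1/(1-xy)]` lies in the sector. -/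
theorem unitSquareRep_mem_chiThreeSector : of unitSquareRep ∈ chiThreeSector :=
  mem_linSector_of_equivalent equivalent_unitSquare_zetaTwo zetaTwoRep_mem_chiThreeSector

/-- The box `B₂` lies in the sector. -/
theorem boxTwo_mem_chiThreeSector : of boxTwo ∈ chiThreeSector := by
  have h : of boxTwo = of unitSquareRep - (of unitSquareRep - of boxTwo) := by abel
  rw [h]
  exact sub_mem unitSquareRep_mem_chiThreeSector
    (relations_le_linSector _ unitSquareRep_sub_boxTwo)

/-- `[T₀] − [T₁]` lies in the sector (it equals `[C]` modulo one move). -/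
theorem hurwitzThreeBox_sub_mem_chiThreeSector :
    of (hurwitzThreeBox 0) - of (hurwitzThreeBox 1) ∈ chiThreeSector := by
  have h : of (hurwitzThreeBox 0) - of (hurwitzThreeBox 1) =
      of chiThreeBox + (of (hurwitzThreeBox 0) - of chiThreeBox - of (hurwitzThreeBox 1)) := by
    abel
  rw [h]
  exact add_mem chiThreeBox_mem
    (relations_le_linSector _ hurwitz_sub_chi_sub_hurwitz_mem_relations)

/-- **[CDT24, Theorem 1] ⟹ KZ for `C` against its sector**: e.g. against any combination of
`B₂`, `Z`, Beukers' square, constants and `C` with value `L(2,χ₋₃)`. -/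
theorem kz_chiThreeBox (hCDT : calegariDimitrovTang_linearIndependent) {m : ℕ}
    (r' : IntegralRep m) (hr' : of r' ∈ chiThreeSector)
    (hv : chiThreeBox.value = r'.value) : Equivalent chiThreeBox r' :=
  kz_chiThreeSector hCDT _ _ chiThreeBox_mem hr' hv

/-- **The irrationality half alone** (`L(2,χ₋₃) ∉ ℚ`, [CDT24, Thm 1, first sentence]; e.g.
`calegariDimitrovTang_linearIndependent.irrational_L2chi3 h`) ⟹ KZ on the `ℚ`-line `L(1, [C])`. -/
theorem kz_chiThreeLine (hirr : Irrational L2chi3) {n m : ℕ}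
    (r : IntegralRep n) (r' : IntegralRep m) (hr : of r ∈ qLine (mkQ (of chiThreeBox)))
    (hr' : of r' ∈ qLine (mkQ (of chiThreeBox))) (hv : r.value = r'.value) : Equivalent r r' :=
  kz_qLine (by rwa [evalQ_mkQ_chiThreeBox]) r r' hr hr' hv

/-! ## [CDT24, Theorem 3] ⟹ KZ on the inhomogeneous two-logarithm sector -/

/-- The four generators `1, ℓ(a), ℓ(b), ℓ(a)ℓ(b)`. -/
def logPairGens (a b : ℝ) : Fin 4 → Q := ![(1 : Q), ell a, ell b, ell a * ell b]

/-- Generator `0`. -/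
@[simp] theorem logPairGens_zero (a b : ℝ) : logPairGens a b 0 = 1 := rfl

/-- Generator `1`. -/
@[simp] theorem logPairGens_one (a b : ℝ) : logPairGens a b 1 = ell a := rfl

/-- Generator `2`. -/
@[simp] theorem logPairGens_two (a b : ℝ) : logPairGens a b 2 = ell b := rfl

/-- Generator `3`. -/
@[simp] theorem logPairGens_three (a b : ℝ) : logPairGens a b 3 = ell a * ell b := rfl

/-- **The two-logarithm sector** `L(1, ℓ(a), ℓ(b), ℓ(a)ℓ(b))`: classes
`c₀ + c₁ℓ(a) + c₂ℓ(b) + c₃ℓ(a)ℓ(b)`, `cᵢ ∈ ℚ` — inhomogeneous of degree `≤ 1` in each logarithm. -/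
abbrev logPairSector (a b : ℝ) : AddSubgroup FormalRep := linSector (logPairGens a b)

/-- The values of the generators: `1, log a, log b, log a · log b` (`a, b ≥ 1` algebraic). -/
theorem evalQ_logPairGens {a b : ℝ} (ha : IsAlgebraic ℚ a) (hb : IsAlgebraic ℚ b) (h1a : 1 ≤ a)
    (h1b : 1 ≤ b) :
    (fun i => evalQ (logPairGens a b i)) =
      ![(1 : ℝ), Real.log a, Real.log b, Real.log a * Real.log b] := by
  funext i
  fin_cases i <;> simp [logPairGens, evalQ_ell ha h1a, evalQ_ell hb h1b, Matrix.cons_val_zero,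
    Matrix.cons_val_one, Matrix.cons_val_two, Matrix.cons_val_three, Matrix.head_cons,
    Matrix.tail_cons]

/-- **KZ on the two-logarithm sector, from the `ℚ`-linear independence of
`1, log a, log b, log a·log b`** (`a, b ≥ 1` real algebraic). -/
theorem kz_logPairSector {a b : ℝ} (ha : IsAlgebraic ℚ a) (hb : IsAlgebraic ℚ b) (h1a : 1 ≤ a)
    (h1b : 1 ≤ b)
    (hind : LinearIndependent ℚ ![(1 : ℝ), Real.log a, Real.log b, Real.log a * Real.log b])
    {n m : ℕ} (r : IntegralRep n) (r' : IntegralRep m) (hr : of r ∈ logPairSector a b)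
    (hr' : of r' ∈ logPairSector a b) (hv : r.value = r'.value) : Equivalent r r' :=
  kz_linSector (by rw [evalQ_logPairGens ha hb h1a h1b]; exact hind) r r' hr hr' hv

/-- The unit log cell `L(1; a) = [(1,a), dx/x]` lies in the sector. -/
theorem logCell_left_mem_logPairSector {a : ℝ} (ha : IsAlgebraic ℚ a) (b : ℝ) :
    of (logCell 1 a isAlgebraic_one ha) ∈ logPairSector a b :=
  mem_linSector_single 1 1
    (by rw [← ell_eq ha]; simp [logPairGens, Matrix.cons_val_one])

/-- The unit log cell `L(1; b)` lies in the sector. -/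
theorem logCell_right_mem_logPairSector (a : ℝ) {b : ℝ} (hb : IsAlgebraic ℚ b) :
    of (logCell 1 b isAlgebraic_one hb) ∈ logPairSector a b :=
  mem_linSector_single 2 1 (by
    rw [← ell_eq hb]
    simp [logPairGens, Matrix.cons_val_two, Matrix.tail_cons, Matrix.head_cons])

/-- **The two-dimensional box `L(1;a) × L(1;b) = [(1,a)×(1,b), dx dy/(xy)]`** lies in the
sector. -/
theorem logCell_prod_mem_logPairSector {a b : ℝ} (ha : IsAlgebraic ℚ a) (hb : IsAlgebraic ℚ b) :
    of ((logCell 1 a isAlgebraic_one ha).prod (logCell 1 b isAlgebraic_one hb)) ∈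
      logPairSector a b :=
  mem_linSector_single 3 1 (by
    rw [← of_mul_of, mkQ_mul, ← ell_eq ha, ← ell_eq hb]
    simp [logPairGens, Matrix.cons_val_three, Matrix.tail_cons, Matrix.head_cons])

/-- The rational constants lie in the sector. -/
theorem constCell_mem_logPairSector (a b : ℝ) (q : ℚ) :
    of (constCell (((q : ℚ) : K₀) : ℝ) (K₀.isAlgebraic _)) ∈ logPairSector a b :=
  constCell_mem_linSector_of_eq_one (logPairGens_zero a b) q

/-- **The irrationality half alone** (`log a · log b ∉ ℚ`) ⟹ KZ on the `ℚ`-line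
`L(1, ℓ(a)ℓ(b))`. -/
theorem kz_logProductLine {a b : ℝ} (ha : IsAlgebraic ℚ a) (hb : IsAlgebraic ℚ b) (h1a : 1 ≤ a)
    (h1b : 1 ≤ b) (hirr : Irrational (Real.log a * Real.log b)) {n m : ℕ} (r : IntegralRep n)
    (r' : IntegralRep m) (hr : of r ∈ qLine (ell a * ell b))
    (hr' : of r' ∈ qLine (ell a * ell b)) (hv : r.value = r'.value) : Equivalent r r' :=
  kz_qLine (by rwa [map_mul, evalQ_ell ha h1a, evalQ_ell hb h1b]) r r' hr hr' hv

/-! ## CDT's family `a = 1 + 1/m`, `b = 1 + 1/n` -/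

/-- `1 + 1/m` is algebraic (it is rational). -/
theorem isAlgebraic_one_add_one_div (m : ℕ) : IsAlgebraic ℚ (1 + 1 / (m : ℝ)) := by
  have h := isAlgebraic_algebraMap (R := ℚ) (A := ℝ) (1 + 1 / (m : ℚ))
  rw [map_add, map_one, map_div₀, map_one, map_natCast] at h
  exact h

/-- `1 ≤ 1 + 1/m`. -/
theorem one_le_one_add_one_div (m : ℕ) : (1 : ℝ) ≤ 1 + 1 / (m : ℝ) :=
  le_add_of_nonneg_right (by positivity)

/-- **[CDT24, Theorem 3] ⟹ the Kontsevich–Zagier conjecture on the sector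
`L(1, ℓ(1+1/m), ℓ(1+1/n), ℓ(1+1/m)ℓ(1+1/n))`.**  The hypothesis is the displayed conclusion of
[CDT24, Thm 3], available for `m ≠ n` with `|m/n − 1| < 10⁻⁶` (e.g. `m = 10⁶ + 1`,
`n = 10⁶ + 2`), and predicted for all `m ≠ n` by the four-exponentials conjecture.  The sector
contains the unit log cells of `log(1+1/m)`, `log(1+1/n)`, their two-dimensional product box,
and the rational constants (lemmas above). -/
theorem kz_logPairSector_succ (m n : ℕ)
    (hCDT : LinearIndependent ℚ
      ![(1 : ℝ), Real.log (1 + 1 / m), Real.log (1 + 1 / n),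
        Real.log (1 + 1 / m) * Real.log (1 + 1 / n)])
    {k l : ℕ} (r : IntegralRep k) (r' : IntegralRep l)
    (hr : of r ∈ logPairSector (1 + 1 / m) (1 + 1 / n))
    (hr' : of r' ∈ logPairSector (1 + 1 / m) (1 + 1 / n)) (hv : r.value = r'.value) :
    Equivalent r r' :=
  kz_logPairSector (isAlgebraic_one_add_one_div m) (isAlgebraic_one_add_one_div n)
    (one_le_one_add_one_div m) (one_le_one_add_one_div n) hCDT r r' hr hr' hv

/-- **[CDT24, Theorem 3, first part] ⟹ KZ on the line through `ℓ(1+1/m)ℓ(1+1/n)`**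
(available for `|m/n − 1| < 10⁻⁶`, including `m = n`). -/
theorem kz_logProductLine_succ (m n : ℕ)
    (hCDT : Irrational (Real.log (1 + 1 / m) * Real.log (1 + 1 / n))) {k l : ℕ}
    (r : IntegralRep k) (r' : IntegralRep l)
    (hr : of r ∈ qLine (ell (1 + 1 / m) * ell (1 + 1 / n)))
    (hr' : of r' ∈ qLine (ell (1 + 1 / m) * ell (1 + 1 / n))) (hv : r.value = r'.value) :
    Equivalent r r' :=
  kz_logProductLine (isAlgebraic_one_add_one_div m) (isAlgebraic_one_add_one_div n)
    (one_le_one_add_one_div m) (one_le_one_add_one_div n) hCDT r r' hr hr' hv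

end SoloBlind

end Summit.KontsevichZagierPeriods.KontsevichZagierPeriods.Theorems
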